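import Summits.ValiantsHypothesis.ValiantsHypothesis.Theorems.NewtonUnitEquationsTwoProductsSubmergedBandStep
import Summits.ValiantsHypothesis.ValiantsHypothesis.Theorems.NewtonUnitEquationsTwoProductsFormalLogLinearisationStubLogLinearisation

/-!
# K4 `submerged-band-filtration` — truncation by a SET of letters (the band step iterated), with the log-support transfer

Tool file for the reduction `SubmergedReduction` (val-idea-36 g0's L2).  `dropSet u D` deletes the monomials `X^e`, `e ∈ D`, from every
tail (= `dropLetter` iterated over `D`, order-independent).  If every letter of `D` weighs `≤ w` for a valid weight `ξ`, then
`∏(1+u_j) − ∏(1+v_j)` and its truncation differ by a polynomial at level `≤ w` (`below_tailDiff_sub_tailDiff_dropSet`, the `Below`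
calculus of `…SubmergedBandStep`), so coefficients and strict tops strictly above `w` are unchanged (`coeff_tailDiff_dropSet`,
`isStrictTop_tailDiff_dropSet_iff`); by the landed log-linearisation `FormalLogLinearisation.stub_logLinearisation` (both directions) the
same holds for strict tops of the LOG-support (`isStrictTop_logSupport_dropSet_iff`), which is the currency of `IsCellFamily` /
`IsSubmergedCellFamily`.  Also: the bookkeeping of the truncated instance (`coeff_dropSet`, `support_dropSet`, `tailSupport_dropSet`,
validity, no constant term, sparsity) and `exists_level_lt` (a finite set of letters strictly below `l` lies below a level `w < wt ξ l`).
Helper mode (`--supports stmt-ValiantsHypothesis-5906 --as helper`).  Honest framing: infrastructure for an exact reduction of the per-cell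
law to submerged cells; nothing here closes 5906 (`TwoProducts` / `ResidualLawV23` / `PlanarCellBound` OPEN); VP ≠ VNP is NOT proved.
No instances, no notation, no named facts. [folklore]
-/

noncomputable section
set_option linter.dupNamespace false

namespace Summit.ValiantsHypothesis.ValiantsHypothesis.Theorems.NewtonUnitEquations.TwoProducts.Submerged
open scoped BigOperators
open MvPolynomial
open Summit.ValiantsHypothesis.ValiantsHypothesis.Theorems.NewtonUnitEquations.TwoProducts.FormalLogLinearisation
open Summit.ValiantsHypothesis.ValiantsHypothesis.Theorems.NewtonUnitEquations.TwoProducts.PlanarCell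

variable {m : ℕ}

/-! ## Truncation by a set of letters -/

/-- Truncation by a SET of letters: delete the monomials `X^e`, `e ∈ D`, from every tail (all positions; apply to both sides).
This is `dropLetter` iterated over `D` (in any order). [folklore] -/
def dropSet (u : Fin m → MvPolynomial (Fin 2) ℂ) (D : Finset Expo) : Fin m → MvPolynomial (Fin 2) ℂ :=
  fun j => u j - ∑ e ∈ D, monomial e (coeff e (u j))

/-- Coefficients of the sum of deleted monomials. [folklore] -/
theorem coeff_sum_monomial (p : MvPolynomial (Fin 2) ℂ) (D : Finset Expo) (x : Expo) :
    coeff x (∑ e ∈ D, monomial e (coeff e p)) = if x ∈ D then coeff x p else 0 := by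
  classical
  rw [coeff_sum]
  simp only [coeff_monomial]
  rw [Finset.sum_ite_eq' D x (fun e => coeff e p)]

/-- Coefficients of the truncated tail: the coefficients at `D` are deleted, all others are unchanged. [folklore] -/
theorem coeff_dropSet (u : Fin m → MvPolynomial (Fin 2) ℂ) (D : Finset Expo) (x : Expo) (j : Fin m) :
    coeff x (dropSet u D j) = if x ∈ D then 0 else coeff x (u j) := by
  classical
  unfold dropSet
  rw [coeff_sub, coeff_sum_monomial]
  split_ifs <;> ring

/-- The support of the truncated tail is the old support minus `D`. [folklore] -/
theorem support_dropSet (u : Fin m → MvPolynomial (Fin 2) ℂ) (D : Finset Expo) (j : Fin m) :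
    (dropSet u D j).support = (u j).support \ D := by
  classical
  ext x
  rw [mem_support_iff, coeff_dropSet, Finset.mem_sdiff, mem_support_iff]
  by_cases h : x ∈ D <;> simp [h]

/-- The support of the truncated tail lies in the old support. [folklore] -/
theorem support_dropSet_subset (u : Fin m → MvPolynomial (Fin 2) ℂ) (D : Finset Expo) (j : Fin m) :
    (dropSet u D j).support ⊆ (u j).support := by
  rw [support_dropSet]; exact Finset.sdiff_subset

/-- Truncation does not increase the number of monomials. [folklore] -/
theorem card_support_dropSet_le (u : Fin m → MvPolynomial (Fin 2) ℂ) (D : Finset Expo) (j : Fin m) :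
    (dropSet u D j).support.card ≤ (u j).support.card :=
  Finset.card_le_card (support_dropSet_subset u D j)

/-- Truncation preserves «no constant term». [folklore] -/
theorem coeff_zero_dropSet (u : Fin m → MvPolynomial (Fin 2) ℂ) (D : Finset Expo) (hu0 : ∀ j, coeff 0 (u j) = 0)
    (j : Fin m) : coeff 0 (dropSet u D j) = 0 := by
  rw [coeff_dropSet]
  split_ifs <;> simp [hu0 j]

/-- Truncation preserves the normalisation-and-sparsity hypothesis of the per-cell laws. [folklore] -/
theorem norm_dropSet {u : Fin m → MvPolynomial (Fin 2) ℂ} {t : ℕ} (D : Finset Expo)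
    (hu : ∀ j, coeff 0 (u j) = 0 ∧ (u j).support.card ≤ t) :
    ∀ j, coeff 0 (dropSet u D j) = 0 ∧ (dropSet u D j).support.card ≤ t := fun j =>
  ⟨coeff_zero_dropSet u D (fun i => (hu i).1) j, (card_support_dropSet_le u D j).trans (hu j).2⟩

/-- A valid weight stays valid after truncation. [folklore] -/
theorem validWeight_dropSet {u v : Fin m → MvPolynomial (Fin 2) ℂ} {ξ : Fin 2 → ℝ} (h : ValidWeight u v ξ)
    (D : Finset Expo) : ValidWeight (dropSet u D) (dropSet v D) ξ :=
  ⟨fun j x hx => h.1 j x (support_dropSet_subset u D j hx),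
    fun j x hx => h.2 j x (support_dropSet_subset v D j hx)⟩

/-- The tail support of the truncated family is the old tail support minus `D`. [folklore] -/
theorem tailSupport_dropSet (u v : Fin m → MvPolynomial (Fin 2) ℂ) (D : Finset Expo) :
    tailSupport (dropSet u D) (dropSet v D) = tailSupport u v \ D := by
  classical
  ext x
  simp only [tailSupport, Finset.mem_union, Finset.mem_biUnion, Finset.mem_univ, true_and, Finset.mem_sdiff,
    support_dropSet]
  constructor
  · rintro (⟨j, hj⟩ | ⟨j, hj⟩)
    · exact ⟨Or.inl ⟨j, hj.1⟩, hj.2⟩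
    · exact ⟨Or.inr ⟨j, hj.1⟩, hj.2⟩
  · rintro ⟨⟨j, hj⟩ | ⟨j, hj⟩, hx⟩
    · exact Or.inl ⟨j, hj, hx⟩
    · exact Or.inr ⟨j, hj, hx⟩

/-- The truncated tail support lies in the old one. [folklore] -/
theorem tailSupport_dropSet_subset (u v : Fin m → MvPolynomial (Fin 2) ℂ) (D : Finset Expo) :
    tailSupport (dropSet u D) (dropSet v D) ⊆ tailSupport u v := by
  rw [tailSupport_dropSet]; exact Finset.sdiff_subset

/-- `(1 + u_j) − (1 + u^D_j) = Σ_{e ∈ D} c_{j,e} X^e`. [folklore] -/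
theorem one_add_sub_one_add_dropSet (u : Fin m → MvPolynomial (Fin 2) ℂ) (D : Finset Expo) (j : Fin m) :
    (1 + u j) - (1 + dropSet u D j) = ∑ e ∈ D, monomial e (coeff e (u j)) := by
  unfold dropSet; ring

/-! ## Level bookkeeping -/

/-- A finite sum of polynomials at level `≤ w` lies at level `≤ w`. [folklore] -/
theorem below_sum {ι : Type*} (ξ : Fin 2 → ℝ) (w : ℝ) (s : Finset ι) (f : ι → MvPolynomial (Fin 2) ℂ)
    (hf : ∀ i ∈ s, Below ξ w (f i)) : Below ξ w (∑ i ∈ s, f i) := by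
  classical
  induction s using Finset.induction_on with
  | empty => intro x hx; simp at hx
  | insert a s ha ih =>
    rw [Finset.sum_insert ha]
    exact (hf a (Finset.mem_insert_self a s)).add (ih fun i hi => hf i (Finset.mem_insert_of_mem hi))

/-- The deleted part `Σ_{e ∈ D} c_e X^e` lies at level `≤ w` when every letter of `D` weighs `≤ w`. [folklore] -/
theorem below_sum_monomial (ξ : Fin 2 → ℝ) (w : ℝ) (D : Finset Expo) (c : Expo → ℂ) (hD : ∀ e ∈ D, wt ξ e ≤ w) :
    Below ξ w (∑ e ∈ D, monomial e (c e)) :=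
  below_sum ξ w D _ fun e he => (below_monomial ξ e (c e)).mono (hD e he)

/-- The product `∏(1+u_j)` and its truncation `∏(1+u^D_j)` differ by a polynomial at level `≤ w`. [folklore] -/
theorem below_prod_sub_prod_dropSet (u : Fin m → MvPolynomial (Fin 2) ℂ) (ξ : Fin 2 → ℝ)
    (hu : ∀ j, ∀ x ∈ (u j).support, wt ξ x < 0) (D : Finset Expo) (w : ℝ) (hD : ∀ e ∈ D, wt ξ e ≤ w) :
    Below ξ w (∏ j, (1 + u j) - ∏ j, (1 + dropSet u D j)) := by
  refine below_prod_sub_prod ξ w Finset.univ (fun j => 1 + u j) (fun j => 1 + dropSet u D j)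
    (fun j _ => below_one_add (hu j)) (fun j _ => below_one_add fun x hx => hu j x (support_dropSet_subset u D j hx))
    fun j _ => ?_
  rw [one_add_sub_one_add_dropSet]
  exact below_sum_monomial ξ w D _ hD

/-- `tailDiff` and its truncation differ by a polynomial at level `≤ w`. [folklore] -/
theorem below_tailDiff_sub_tailDiff_dropSet (u v : Fin m → MvPolynomial (Fin 2) ℂ) (ξ : Fin 2 → ℝ)
    (hξ : ValidWeight u v ξ) (D : Finset Expo) (w : ℝ) (hD : ∀ e ∈ D, wt ξ e ≤ w) :
    Below ξ w (tailDiff u v - tailDiff (dropSet u D) (dropSet v D)) := by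
  have key : tailDiff u v - tailDiff (dropSet u D) (dropSet v D) =
      (∏ j, (1 + u j) - ∏ j, (1 + dropSet u D j)) - (∏ j, (1 + v j) - ∏ j, (1 + dropSet v D j)) := by
    unfold tailDiff; ring
  rw [key]
  exact (below_prod_sub_prod_dropSet u ξ hξ.1 D w hD).sub (below_prod_sub_prod_dropSet v ξ hξ.2 D w hD)

/-- **Coefficients strictly above the deleted letters are unchanged.** [folklore] -/
theorem coeff_tailDiff_dropSet (u v : Fin m → MvPolynomial (Fin 2) ℂ) (ξ : Fin 2 → ℝ) (hξ : ValidWeight u v ξ)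
    (D : Finset Expo) (w : ℝ) (hD : ∀ e ∈ D, wt ξ e ≤ w) (x : Expo) (hx : w < wt ξ x) :
    coeff x (tailDiff u v) = coeff x (tailDiff (dropSet u D) (dropSet v D)) :=
  coeff_eq_of_below_sub (below_tailDiff_sub_tailDiff_dropSet u v ξ hξ D w hD) x hx

/-- **Strict tops of `supp(∏(1+u) − ∏(1+v))` strictly above the deleted letters are unchanged.** [folklore] -/
theorem isStrictTop_tailDiff_dropSet_iff (u v : Fin m → MvPolynomial (Fin 2) ℂ) (ξ : Fin 2 → ℝ)
    (hξ : ValidWeight u v ξ) (D : Finset Expo) (w : ℝ) (hD : ∀ e ∈ D, wt ξ e ≤ w) (l : Expo) (hl : w < wt ξ l) :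
    IsStrictTop ξ (↑(tailDiff u v).support) l ↔
      IsStrictTop ξ (↑(tailDiff (dropSet u D) (dropSet v D)).support) l :=
  isStrictTop_support_iff_of_coeff_eq ξ w _ _ (fun x hx => coeff_tailDiff_dropSet u v ξ hξ D w hD x hx) l hl

/-- **Strict tops of the LOG-support strictly above the deleted letters are unchanged** (log-linearisation both ways, landed
`FormalLogLinearisation.stub_logLinearisation`). [folklore] -/
theorem isStrictTop_logSupport_dropSet_iff (u v : Fin m → MvPolynomial (Fin 2) ℂ) (hu0 : ∀ j, coeff 0 (u j) = 0)
    (hv0 : ∀ j, coeff 0 (v j) = 0) (ξ : Fin 2 → ℝ) (hξ : ValidWeight u v ξ) (D : Finset Expo) (w : ℝ)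
    (hD : ∀ e ∈ D, wt ξ e ≤ w) (l : Expo) (hl : w < wt ξ l) :
    IsStrictTop ξ (logSupport u v) l ↔ IsStrictTop ξ (logSupport (dropSet u D) (dropSet v D)) l := by
  rw [← stub_logLinearisation m u v hu0 hv0 ξ hξ l,
    ← stub_logLinearisation m (dropSet u D) (dropSet v D) (coeff_zero_dropSet u D hu0) (coeff_zero_dropSet v D hv0) ξ
      (validWeight_dropSet hξ D) l]
  exact isStrictTop_tailDiff_dropSet_iff u v ξ hξ D w hD l hl

/-- A finite set of letters each strictly below `l` lies below some level `w < wt ξ l`. [folklore] -/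
theorem exists_level_lt (ξ : Fin 2 → ℝ) (D : Finset Expo) (l : Expo) (hD : ∀ e ∈ D, wt ξ e < wt ξ l) :
    ∃ w : ℝ, w < wt ξ l ∧ ∀ e ∈ D, wt ξ e ≤ w := by
  classical
  induction D using Finset.induction_on with
  | empty => exact ⟨wt ξ l - 1, by linarith, by simp⟩
  | insert a s ha ih =>
    obtain ⟨w, hw, hws⟩ := ih fun e he => hD e (Finset.mem_insert_of_mem he)
    refine ⟨max w (wt ξ a), max_lt hw (hD a (Finset.mem_insert_self a s)), fun e he => ?_⟩
    rcases Finset.mem_insert.1 he with rfl | he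
    · exact le_max_right _ _
    · exact (hws e he).trans (le_max_left _ _)

/-- **Transfer of a strict log-top to the truncation by the letters strictly below it** (packaged for the reduction). [folklore] -/
theorem isStrictTop_logSupport_dropSet_of_lt (u v : Fin m → MvPolynomial (Fin 2) ℂ) (hu0 : ∀ j, coeff 0 (u j) = 0)
    (hv0 : ∀ j, coeff 0 (v j) = 0) (ξ : Fin 2 → ℝ) (hξ : ValidWeight u v ξ) (D : Finset Expo) (l : Expo)
    (hD : ∀ e ∈ D, wt ξ e < wt ξ l) (hl : IsStrictTop ξ (logSupport u v) l) :
    IsStrictTop ξ (logSupport (dropSet u D) (dropSet v D)) l := by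
  obtain ⟨w, hw, hDw⟩ := exists_level_lt ξ D l hD
  exact (isStrictTop_logSupport_dropSet_iff u v hu0 hv0 ξ hξ D w hDw l hw).1 hl

end Summit.ValiantsHypothesis.ValiantsHypothesis.Theorems.NewtonUnitEquations.TwoProducts.Submerged

end
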